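import Mathlib
import HarnessLib

/-!
# Route `IntegerScrew` — pricing a superposition of windows: the seminorm step of the mixture lemma
# (CONTINUUM-LIMIT §25.10 (c)–(d) in the kernel; Mathlib only)

`IntegerScrewTiltMixture.tilt_centred_eq_sum_windows` writes a centred tilt functional as
`Σ_θ Δτ(θ)·Br(θ)`; `IntegerScrewExitAtomTilt.window_functional_sq_le_atom_tilt` carries the term
`(Σ_θ |Δτ(θ)|·|Br(θ)|)²`.  Each bracket obeys a WINDOW BOUND `Br(θ)² ≤ k(θ)²·D` with its own constant `k(θ)`
(THEOREM A's chain for thick bottoms, `IntegerScrewBracketPoincare` for thin ones).  This file is the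
Cauchy–Schwarz/triangle bookkeeping that turns per-threshold bounds into the bound of the superposition —
the «`𝓔*^{1/2}` is a seminorm» step of 25.10 (c):

* `abs_le_mul_sqrt_of_sq_le` — `x² ≤ k²·D`, `k ≥ 0` ⇒ `|x| ≤ k·√D`;
* **`sq_sum_mul_abs_le_of_sq_le`** — `(Σ_θ c(θ)|x(θ)|)² ≤ (Σ_θ c(θ)k(θ))²·D` when `x(θ)² ≤ k(θ)²·D`, `c, k ≥ 0`;
* `sq_sum_mul_abs_le_of_sq_le_min` — the same with `k = min(k₁, k₂)` from two families of window bounds.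

RH-free; nothing in this file bears on the truth of RH.
References: CONTINUUM-LIMIT §25.10 (rh-explicit A6-PIVOT); M. Suzuki, J. Lond. Math. Soc. (2) 108 (2023)
1448–1487 [Suzuki2023].
-/

noncomputable section

set_option linter.dupNamespace false -- D-0017: `Summit.<S>.<S>.…` is the designed namespace

namespace Summit.RiemannHypothesis.RiemannHypothesis.Theorems.IntegerScrew

open Finset Real

/-- `x² ≤ k²·D` with `k ≥ 0`, `D ≥ 0` gives `|x| ≤ k·√D`. -/
theorem abs_le_mul_sqrt_of_sq_le {x k D : ℝ} (hk : 0 ≤ k) (hD : 0 ≤ D) (h : x ^ 2 ≤ k ^ 2 * D) :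
    |x| ≤ k * Real.sqrt D := by
  have h2 : x ^ 2 ≤ (k * Real.sqrt D) ^ 2 := by
    rw [mul_pow, Real.sq_sqrt hD]; exact h
  exact abs_le_of_sq_le_sq' h2 (mul_nonneg hk (Real.sqrt_nonneg D)) |>.2 |> fun hx =>
    abs_le.2 ⟨(abs_le_of_sq_le_sq' h2 (mul_nonneg hk (Real.sqrt_nonneg D))).1, hx⟩

/-- **The seminorm step**: if `x(θ)² ≤ k(θ)²·D` for `θ ∈ s` (`c, k ≥ 0` on `s`, `D ≥ 0`), then
`(Σ_{θ∈s} c(θ)·|x(θ)|)² ≤ (Σ_{θ∈s} c(θ)·k(θ))²·D`. -/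
theorem sq_sum_mul_abs_le_of_sq_le {s : Finset ℕ} {c x k : ℕ → ℝ} {D : ℝ} (hD : 0 ≤ D)
    (hc : ∀ θ ∈ s, 0 ≤ c θ) (hk : ∀ θ ∈ s, 0 ≤ k θ) (hx : ∀ θ ∈ s, x θ ^ 2 ≤ k θ ^ 2 * D) :
    (∑ θ ∈ s, c θ * |x θ|) ^ 2 ≤ (∑ θ ∈ s, c θ * k θ) ^ 2 * D := by
  have h1 : ∑ θ ∈ s, c θ * |x θ| ≤ (∑ θ ∈ s, c θ * k θ) * Real.sqrt D := by
    rw [Finset.sum_mul]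
    refine Finset.sum_le_sum fun θ hθ => ?_
    rw [mul_assoc]
    exact mul_le_mul_of_nonneg_left (abs_le_mul_sqrt_of_sq_le (hk θ hθ) hD (hx θ hθ)) (hc θ hθ)
  have h0 : 0 ≤ ∑ θ ∈ s, c θ * |x θ| := Finset.sum_nonneg fun θ hθ => mul_nonneg (hc θ hθ) (abs_nonneg _)
  calc (∑ θ ∈ s, c θ * |x θ|) ^ 2 ≤ ((∑ θ ∈ s, c θ * k θ) * Real.sqrt D) ^ 2 :=
        pow_le_pow_left₀ h0 h1 2
    _ = (∑ θ ∈ s, c θ * k θ) ^ 2 * D := by rw [mul_pow, Real.sq_sqrt hD]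

/-- **Two families of window bounds, the better one at each threshold**: if `x(θ)² ≤ k₁(θ)²·D` and
`x(θ)² ≤ k₂(θ)²·D` on `s` (`c, k₁, k₂ ≥ 0`), then `(Σ c|x|)² ≤ (Σ c·min(k₁,k₂))²·D`. -/
theorem sq_sum_mul_abs_le_of_sq_le_min {s : Finset ℕ} {c x k₁ k₂ : ℕ → ℝ} {D : ℝ} (hD : 0 ≤ D)
    (hc : ∀ θ ∈ s, 0 ≤ c θ) (hk₁ : ∀ θ ∈ s, 0 ≤ k₁ θ) (hk₂ : ∀ θ ∈ s, 0 ≤ k₂ θ)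
    (hx₁ : ∀ θ ∈ s, x θ ^ 2 ≤ k₁ θ ^ 2 * D) (hx₂ : ∀ θ ∈ s, x θ ^ 2 ≤ k₂ θ ^ 2 * D) :
    (∑ θ ∈ s, c θ * |x θ|) ^ 2 ≤ (∑ θ ∈ s, c θ * min (k₁ θ) (k₂ θ)) ^ 2 * D := by
  refine sq_sum_mul_abs_le_of_sq_le hD hc (fun θ hθ => le_min (hk₁ θ hθ) (hk₂ θ hθ)) fun θ hθ => ?_
  rcases le_total (k₁ θ) (k₂ θ) with h | h
  · rw [min_eq_left h]; exact hx₁ θ hθ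
  · rw [min_eq_right h]; exact hx₂ θ hθ

/-- The converse packaging: `|x| ≤ k·√D` with `D ≥ 0` gives `x² ≤ k²·D`. -/
theorem sq_le_mul_of_abs_le_mul_sqrt {x k D : ℝ} (hD : 0 ≤ D) (h : |x| ≤ k * Real.sqrt D) :
    x ^ 2 ≤ k ^ 2 * D := by
  have h0 : 0 ≤ k * Real.sqrt D := (abs_nonneg x).trans h
  have h2 : |x| ^ 2 ≤ (k * Real.sqrt D) ^ 2 := pow_le_pow_left₀ (abs_nonneg x) h 2
  rw [sq_abs, mul_pow, Real.sq_sqrt hD] at h2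
  exact h2

end Summit.RiemannHypothesis.RiemannHypothesis.Theorems.IntegerScrew

end
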